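import Mathlib
import HarnessLib
import Summits.QuantumFields.YangMills.Theses.PencilRigidity
import Summits.QuantumFields.YangMills.Theorems.PencilRigidityCurvatureKernelBoundDegenerateAxialGrowth
import Summits.QuantumFields.YangMills.Theorems.PencilRigidityCurvatureKernelBoundBoundedRenormalisationAxialGrowth
import Summits.QuantumFields.YangMills.Theorems.PencilRigidityCurvatureKernelBoundLatticeWindowTransferLemmas

/-!
# `CurvatureKernelBound` — stub B₂ `TwoPointLocalBoundSemiDegenerate` (support for stmt-QuantumFields-11687, line `sixteen-charts-analytic-kernel`, skeleton v11)

`W₁` + (factorising two-point function OR frequently bounded `c_k`) ⇒ the local two-point bounds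
near the time axis with BOUNDED constants (`p₀ = 0`, `s₁ = 1`, `r₀ = s/2`).

Route. `S₁ 1 = κ∫` on real one-point tensors (translation clause of `W₁`,
`BoundedRenormalisation.exists_degreeOne_eq_const_mul_realIntegral`). For real `f 0, f 1` supported
in two disjoint closed balls of radius `r` the tensor `F = f 0 ⊗ f 1` is off-diagonal, and the
truncated part `S₁ 2 F − κ(∫ f 0) κ(∫ f 1)` is bounded by `B r⁸ M₀ M₁` (`|f i| ≤ M_i`):
* factorising branch: it vanishes (`B = 0`);
* bounded branch: along the subsequence `|c_k| ≤ M`, L1 `LatticeTruncatedTwoPointBound` and the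
  lattice point count `a⁴ Σ_{x ∈ box} |g(a x)| ≤ (3r)⁴ M_g` (`tsupport g ⊆ B̄(c, r)`, `|g| ≤ M_g`,
  `0 < a ≤ r`) bound the truncated lattice two-point function by `M² (2B_Q)² (3r)⁸ M₀ M₁`
  (`|tr F²| ≤ B_Q`), and the lattice tie of `W₁` at `n = 2, 1` passes this to the limit.
Hence `‖S₁ 2 F‖ ≤ ‖κ‖² (∫|f 0|)(∫|f 1|) + B r⁸ M₀ M₁`: `A = ‖κ‖²`, `A₀ = A + B`. [folklore]
-/

noncomputable section

open scoped BigOperators Topology SchwartzMap ComplexConjugate InnerProductSpace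
open MeasureTheory Filter Set Metric
open Literature.MathematicalPhysics.QuantumLattice Literature.MathematicalPhysics.AQFT
open Literature.MathematicalPhysics.QuantumFieldTheory

namespace Summit.QuantumFields.YangMills.Theorems.CurvatureKernel

namespace SemiDegenerate

open Literature.Probability.LatticeModels (Site box mem_box)

/-- Complexification does not change the topological support of a real test function. [folklore] -/
theorem tsupport_ofRealTest (g : 𝓢(EuclideanSpace ℝ (Fin 4), ℝ)) :
    tsupport (ofRealTest g : EuclideanSpace ℝ (Fin 4) → ℂ) =
      tsupport (g : EuclideanSpace ℝ (Fin 4) → ℝ) := by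
  unfold tsupport
  congr 1
  ext y
  simp [ofRealTest_apply]

/-- A real two-point tensor `F = f 0 ⊗ f 1` whose factors have disjoint supports is off-diagonal
(`F` is the tree's `tensorFin 2`, by uniqueness of tensors). [folklore] -/
theorem isOffDiagonal_of_isTensorOf_of_disjoint {f : Fin 2 → 𝓢(EuclideanSpace ℝ (Fin 4), ℝ)}
    {F : 𝓢((Fin 2 → EuclideanSpace ℝ (Fin 4)), ℂ)} (hF : IsTensorOf F (fun i => ofRealTest (f i)))
    (h : Disjoint (tsupport (f 0 : EuclideanSpace ℝ (Fin 4) → ℝ))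
      (tsupport (f 1 : EuclideanSpace ℝ (Fin 4) → ℝ))) :
    IsOffDiagonal F := by
  have hT : IsTensorOf (SchwartzMap.tensorFin 2 ![ofRealTest (f 0), ofRealTest (f 1)])
      (fun i => ofRealTest (f i)) := by
    intro x
    rw [SchwartzMap.tensorFin_apply]
    refine Finset.prod_congr rfl fun i _ => ?_
    fin_cases i <;> rfl
  rw [hF.unique hT]
  refine isOffDiagonal_tensorFin_two ?_
  rwa [tsupport_ofRealTest, tsupport_ofRealTest]

/-- **Lattice point count** for a function `g` supported in a closed ball of radius `r` and bounded
by `M_g`: for meshes `0 < a ≤ r` and every box, `a⁴ Σ_{x ∈ box} |g(a x)| ≤ (3r)⁴ M_g` — each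
coordinate of a contributing site lies in an interval of length `2r/a`, which holds at most
`2r/a + 1` integers (adapted from `BoundedRenormalisation.latticeSum_bump_le`). [folklore] -/
theorem latticeSum_le_of_tsupport_subset_closedBall' {c : EuclideanSpace ℝ (Fin 4)} {r : ℝ}
    {g : EuclideanSpace ℝ (Fin 4) → ℝ} (hg : tsupport g ⊆ closedBall c r) {Mg : ℝ}
    (hM : ∀ y, |g y| ≤ Mg) {a : ℝ} (ha : 0 < a) (har : a ≤ r) (L : ℕ) :
    a ^ 4 * ∑ x ∈ box 4 L, |g (a • siteToE x)| ≤ (3 * r) ^ 4 * Mg := by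
  have hr : 0 < r := ha.trans_le har
  have hMg : 0 ≤ Mg := (abs_nonneg _).trans (hM c)
  -- the contributing sites lie in a product of integer intervals
  set T : Finset (Site 4) := Fintype.piFinset fun i : Fin 4 =>
    Finset.Icc ⌈(c i - r) / a⌉ ⌊(c i + r) / a⌋ with hT
  have hsub : (box 4 L).filter (fun x => g (a • siteToE x) ≠ 0) ⊆ T := by
    intro x hx
    rw [Finset.mem_filter] at hx
    have hball : a • siteToE x ∈ closedBall c r := hg (subset_tsupport _ hx.2)
    rw [mem_closedBall, dist_eq_norm] at hball
    rw [hT, Fintype.mem_piFinset]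
    intro i
    have hi : |a * (x i : ℝ) - c i| ≤ r := by
      have h1 : |(a • siteToE x - c) i| ≤ ‖a • siteToE x - c‖ := by
        simpa using PiLp.norm_apply_le (a • siteToE x - c) i
      rw [PiLp.sub_apply, PiLp.smul_apply, siteToE_apply, smul_eq_mul] at h1
      exact h1.trans hball
    rw [abs_le] at hi
    rw [Finset.mem_Icc, Int.ceil_le, Int.le_floor, div_le_iff₀ ha, le_div_iff₀ ha]
    constructor <;> linarith
  have hsum : ∑ x ∈ box 4 L, |g (a • siteToE x)| ≤ (T.card : ℝ) * Mg := by
    calc ∑ x ∈ box 4 L, |g (a • siteToE x)|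
        = ∑ x ∈ (box 4 L).filter (fun x => g (a • siteToE x) ≠ 0), |g (a • siteToE x)| :=
          (Finset.sum_filter_of_ne fun x _ h => abs_ne_zero.mp h).symm
      _ ≤ ∑ x ∈ (box 4 L).filter (fun x => g (a • siteToE x) ≠ 0), Mg :=
          Finset.sum_le_sum fun x _ => hM _
      _ ≤ (T.card : ℝ) * Mg := by
          rw [Finset.sum_const, nsmul_eq_mul]
          exact mul_le_mul_of_nonneg_right (by exact_mod_cast Finset.card_le_card hsub) hMg
  have hcard : (T.card : ℝ) ≤ (2 * r / a + 1) ^ 4 := by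
    rw [hT, Fintype.card_piFinset]
    push_cast
    rw [show (2 * r / a + 1) ^ 4 = ∏ _i : Fin 4, (2 * r / a + 1) by
      rw [Finset.prod_const, Finset.card_univ, Fintype.card_fin]]
    refine Finset.prod_le_prod (fun i _ => by positivity) fun i _ => ?_
    rw [Int.card_Icc]
    have h1 : (⌊(c i + r) / a⌋ : ℝ) ≤ (c i + r) / a := Int.floor_le _
    have h2 : (c i - r) / a ≤ (⌈(c i - r) / a⌉ : ℝ) := Int.le_ceil _
    have h3 : (c i + r) / a - (c i - r) / a = 2 * r / a := by ring
    have h4 : (0 : ℝ) ≤ 2 * r / a := div_nonneg (by linarith) ha.le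
    have hN : (((⌊(c i + r) / a⌋ + 1 - ⌈(c i - r) / a⌉).toNat : ℕ) : ℝ) =
        max ((⌊(c i + r) / a⌋ : ℝ) + 1 - (⌈(c i - r) / a⌉ : ℝ)) 0 := by
      rw [← Int.cast_natCast, Int.toNat_eq_max]
      push_cast
      rfl
    rw [hN]
    exact max_le (by linarith) (by linarith)
  calc a ^ 4 * ∑ x ∈ box 4 L, |g (a • siteToE x)| ≤ a ^ 4 * ((2 * r / a + 1) ^ 4 * Mg) :=
        mul_le_mul_of_nonneg_left (hsum.trans (mul_le_mul_of_nonneg_right hcard hMg))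
          (by positivity)
    _ = (2 * r + a) ^ 4 * Mg := by
        rw [← mul_assoc, ← mul_pow]
        congr 2
        field_simp
    _ ≤ (3 * r) ^ 4 * Mg :=
        mul_le_mul_of_nonneg_right (pow_le_pow_left₀ (by linarith) (by linarith) 4) hMg

/-- **Lattice side, general test functions.** If real sequences `LS₂, LS_g, LS_h` (the smeared
lattice two- and one-point functions of `g₀, g₁`) obey the bound of stub L1,
`|LS₂ − LS_g LS_h| ≤ c_k² (2B)² R_k(g₀) R_k(g₁)`, the `g_i` are supported in closed balls of radius
`r > 0` with `|g_i| ≤ M_i`, and along `φ` one has `|c_{φ j}| ≤ M`, `a_{φ j} → 0`, then eventually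
along `φ`: `‖LS₂ − LS_g LS_h‖ ≤ M² (2B)² ((3r)⁴ M₀) ((3r)⁴ M₁)` (lattice point count). [folklore] -/
theorem eventually_norm_truncated_le' {c₀ c₁ : EuclideanSpace ℝ (Fin 4)} {r : ℝ} (hr : 0 < r)
    {g₀ g₁ : EuclideanSpace ℝ (Fin 4) → ℝ} (hg₀ : tsupport g₀ ⊆ closedBall c₀ r)
    (hg₁ : tsupport g₁ ⊆ closedBall c₁ r) {M₀ M₁ : ℝ} (hM₀ : ∀ y, |g₀ y| ≤ M₀)
    (hM₁ : ∀ y, |g₁ y| ≤ M₁)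
    {LS₂ LSg LSh c a : ℕ → ℝ} {L : ℕ → ℕ} {B M : ℝ} {φ : ℕ → ℕ}
    (ha : ∀ k, 0 < a k) (hφa : Tendsto (fun j => a (φ j)) atTop (𝓝 0))
    (hφM : ∀ j, |c (φ j)| ≤ M)
    (hL1 : ∀ k, |LS₂ k - LSg k * LSh k| ≤ c k ^ 2 * (2 * B) ^ 2 *
      (a k ^ 4 * ∑ x ∈ box 4 (L k), |g₀ (a k • siteToE x)|) *
      (a k ^ 4 * ∑ x ∈ box 4 (L k), |g₁ (a k • siteToE x)|)) :
    ∀ᶠ j in atTop, ‖((LS₂ (φ j) : ℝ) : ℂ) - ((LSg (φ j) : ℝ) : ℂ) * ((LSh (φ j) : ℝ) : ℂ)‖ ≤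
      M ^ 2 * (2 * B) ^ 2 * ((3 * r) ^ 4 * M₀) * ((3 * r) ^ 4 * M₁) := by
  have hM₀0 : 0 ≤ M₀ := (abs_nonneg _).trans (hM₀ c₀)
  have hM₁0 : 0 ≤ M₁ := (abs_nonneg _).trans (hM₁ c₁)
  filter_upwards [hφa.eventually (gt_mem_nhds hr)] with j hj
  rw [← Complex.ofReal_mul, ← Complex.ofReal_sub, Complex.norm_real, Real.norm_eq_abs]
  refine (hL1 (φ j)).trans ?_
  have hM0 : 0 ≤ M := (abs_nonneg _).trans (hφM j)
  have hc2 : c (φ j) ^ 2 ≤ M ^ 2 := by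
    rw [← sq_abs]
    exact pow_le_pow_left₀ (abs_nonneg _) (hφM j) 2
  have hR₀ := latticeSum_le_of_tsupport_subset_closedBall' hg₀ hM₀ (ha (φ j)) hj.le (L (φ j))
  have hR₁ := latticeSum_le_of_tsupport_subset_closedBall' hg₁ hM₁ (ha (φ j)) hj.le (L (φ j))
  gcongr ?_ * _ * ?_ * ?_

/-- `‖κ (∫ f 0) · κ (∫ f 1)‖ ≤ ‖κ‖² (∫ |f 0|) (∫ |f 1|)`. [folklore] -/
theorem norm_disconnected_le (κ : ℂ) (f : Fin 2 → 𝓢(EuclideanSpace ℝ (Fin 4), ℝ)) :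
    ‖κ * ((∫ x : EuclideanSpace ℝ (Fin 4), f 0 x : ℝ) : ℂ) *
        (κ * ((∫ x : EuclideanSpace ℝ (Fin 4), f 1 x : ℝ) : ℂ))‖ ≤
      ‖κ‖ ^ 2 * (∫ x : EuclideanSpace ℝ (Fin 4), |f 0 x|) * (∫ x : EuclideanSpace ℝ (Fin 4), |f 1 x|) := by
  rw [norm_mul, norm_mul, norm_mul, Complex.norm_real, Complex.norm_real, Real.norm_eq_abs,
    Real.norm_eq_abs]
  have h0 : |∫ x : EuclideanSpace ℝ (Fin 4), f 0 x| ≤ ∫ x : EuclideanSpace ℝ (Fin 4), |f 0 x| :=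
    abs_integral_le_integral_abs
  have h1 : |∫ x : EuclideanSpace ℝ (Fin 4), f 1 x| ≤ ∫ x : EuclideanSpace ℝ (Fin 4), |f 1 x| :=
    abs_integral_le_integral_abs
  calc ‖κ‖ * |∫ x : EuclideanSpace ℝ (Fin 4), f 0 x| * (‖κ‖ * |∫ x : EuclideanSpace ℝ (Fin 4), f 1 x|)
      = ‖κ‖ ^ 2 * (|∫ x : EuclideanSpace ℝ (Fin 4), f 0 x| * |∫ x : EuclideanSpace ℝ (Fin 4), f 1 x|) := by
        ring
    _ ≤ ‖κ‖ ^ 2 * ((∫ x : EuclideanSpace ℝ (Fin 4), |f 0 x|) * ∫ x : EuclideanSpace ℝ (Fin 4), |f 1 x|) :=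
        mul_le_mul_of_nonneg_left (mul_le_mul h0 h1 (abs_nonneg _)
          (integral_nonneg fun _ => abs_nonneg _)) (sq_nonneg _)
    _ = _ := by ring

/-- The closed balls of radius `r ≤ s/2` centred at `∓ s e₀` (`s > 0`) are disjoint. [folklore] -/
theorem disjoint_closedBall_single {s r : ℝ} (hs : 0 < s) (hr : r ≤ s / 2) :
    Disjoint (closedBall (EuclideanSpace.single (0 : Fin 4) (-s) : EuclideanSpace ℝ (Fin 4)) r)
      (closedBall (EuclideanSpace.single (0 : Fin 4) s : EuclideanSpace ℝ (Fin 4)) r) := by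
  refine closedBall_disjoint_closedBall ?_
  rw [PiLp.dist_single_same, Real.dist_eq, show -s - s = -(2 * s) by ring, abs_neg,
    abs_of_pos (by linarith)]
  linarith

end SemiDegenerate

open SemiDegenerate BoundedRenormalisation in
/-- **Stub `TwoPointLocalBoundSemiDegenerate`** (registered signature verbatim). `W₁` + (factorising
two-point function OR frequently bounded `c_k`) ⇒ the local two-point bounds near the time axis
with bounded constants: `s₁ = 1`, `p₀ = 0`, `r₀ = s/2`, `A = ‖κ‖²` (`S₁ 1 = κ∫`), `B = 0`
(factorising) resp. `B = M² (2B_Q)² 3⁸` (bounded `c_k`, via L1 and the lattice tie), `A₀ = A + B`.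
See the module docstring. [folklore] -/
theorem TwoPointLocalBoundSemiDegenerate : open Literature.MathematicalPhysics.QuantumLattice Literature.MathematicalPhysics.AQFT Literature.MathematicalPhysics.QuantumFieldTheory in ∀ (G : Type) [Group G] [TopologicalSpace G] [IsTopologicalGroup G] [CompactSpace G] [MeasurableSpace G] [BorelSpace G], IsCompactSimpleLieGroup G → ∀ (r : LatticeRep G) (sch : SpeciesScheme (YMSpecies G)) (S₁ : SchwingerFamily (EuclideanSpace ℝ (Fin 4))), ((∀ (n : ℕ), n ≠ 0 → ∀ (f : Fin n → SchwartzMap (EuclideanSpace ℝ (Fin 4)) ℝ) (F : SchwartzMap (Fin n → (EuclideanSpace ℝ (Fin 4))) ℂ), IsTensorOf F (fun i => ofRealTest (f i)) → IsOffDiagonal F → Filter.Tendsto (fun k : ℕ => ((latticeSchwinger r.ρ sch (fun s => s.F) k n (fun _ => r.curvature) f : ℝ) : ℂ)) Filter.atTop (nhds (S₁ n F))) ∧ (S₁.toLabelled.IsNormalized ∧ S₁.toLabelled.IsHermitian ∧ S₁.toLabelled.HasLinearGrowth ∧ S₁.toLabelled.IsReflectionPositive ∧ S₁.toLabelled.IsSymmetric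 ∧ S₁.toLabelled.HasClusterProperty) ∧ (∀ (n : ℕ) (a : (EuclideanSpace ℝ (Fin 4))) (F : SchwartzMap (Fin n → (EuclideanSpace ℝ (Fin 4))) ℂ), IsOffDiagonal F → S₁ n (translateMulti a F) = S₁ n F) ∧ (∀ (R : (EuclideanSpace ℝ (Fin 4)) ≃ₗᵢ[ℝ] (EuclideanSpace ℝ (Fin 4))), LinearMap.det (R.toLinearEquiv : (EuclideanSpace ℝ (Fin 4)) →ₗ[ℝ] (EuclideanSpace ℝ (Fin 4))) = 1 → (∀ i : Fin 4, ∃ j : Fin 4, R (EuclideanSpace.single i 1) = EuclideanSpace.single j 1 ∨ R (EuclideanSpace.single i 1) = -EuclideanSpace.single j 1) → ∀ (n : ℕ) (F : SchwartzMap (Fin n → (EuclideanSpace ℝ (Fin 4))) ℂ), IsOffDiagonal F → S₁ n (linActMulti R F) = S₁ n F) ∧ (∃ Δ : ℝ, 0 < Δ ∧ S₁.toLabelled.HasMassGap Δ ∧ HasLatticeMassGap r sch Δ)) → ((∀ (f : Fin 2 → SchwartzMap (EuclideanSpace ℝ (Fin 4)) ℝ) (F : SchwartzMap (Fin 2 →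 (EuclideanSpace ℝ (Fin 4))) ℂ) (F₀ F₁ : SchwartzMap (Fin 1 → (EuclideanSpace ℝ (Fin 4))) ℂ), IsTensorOf F (fun i => ofRealTest (f i)) → IsOffDiagonal F → IsTensorOf F₀ (fun _ => ofRealTest (f 0)) → IsTensorOf F₁ (fun _ => ofRealTest (f 1)) → S₁ 2 F = S₁ 1 F₀ * S₁ 1 F₁) ∨ (∃ M : ℝ, ∃ᶠ k in Filter.atTop, |sch.c r.curvature k| ≤ M)) → ∃ (s₁ A₀ : ℝ) (p₀ : ℕ), 0 < s₁ ∧ 0 ≤ A₀ ∧ (∀ (s : ℝ), 0 < s → s < s₁ → ∃ (r₀ A B : ℝ), 0 < r₀ ∧ 0 ≤ A ∧ 0 ≤ B ∧ A + B ≤ A₀ * (1 + s⁻¹ ^ p₀) ∧ (∀ (r : ℝ), 0 < r → r ≤ r₀ → ∀ (f : Fin 2 → SchwartzMap (EuclideanSpace ℝ (Fin 4)) ℝ) (F : SchwartzMap (Fin 2 → (EuclideanSpace ℝ (Fin 4))) ℂ) (M₀ M₁ : ℝ), IsTensorOf F (fun i => ofRealTest (f i)) → tsupport ((f 0 : SchwartzMap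 (EuclideanSpace ℝ (Fin 4)) ℝ) : (EuclideanSpace ℝ (Fin 4)) → ℝ) ⊆ Metric.closedBall (EuclideanSpace.single (0 : Fin 4) (-s)) r → tsupport ((f 1 : SchwartzMap (EuclideanSpace ℝ (Fin 4)) ℝ) : (EuclideanSpace ℝ (Fin 4)) → ℝ) ⊆ Metric.closedBall (EuclideanSpace.single (0 : Fin 4) s) r → (∀ x, |f 0 x| ≤ M₀) → (∀ x, |f 1 x| ≤ M₁) → ‖S₁ 2 F‖ ≤ A * (∫ x : (EuclideanSpace ℝ (Fin 4)), |f 0 x|) * (∫ x : (EuclideanSpace ℝ (Fin 4)), |f 1 x|) + B * r ^ 8 * M₀ * M₁)) := by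
  intro G _ _ _ _ _ _ _ r sch S₁ hW₁ halt
  obtain ⟨htie, -, htr, -, -⟩ := hW₁
  obtain ⟨κ, hκ⟩ := exists_degreeOne_eq_const_mul_realIntegral S₁ htr
  -- ### the truncated part is `O(r⁸ M₀ M₁)` on real tensors supported in disjoint `r`-balls
  obtain ⟨B, hB0, hB⟩ : ∃ B : ℝ, 0 ≤ B ∧ ∀ (c₀ c₁ : EuclideanSpace ℝ (Fin 4)) (ρ : ℝ), 0 < ρ →
      Disjoint (closedBall c₀ ρ) (closedBall c₁ ρ) →
      ∀ (f : Fin 2 → 𝓢(EuclideanSpace ℝ (Fin 4), ℝ)) (F : 𝓢((Fin 2 → EuclideanSpace ℝ (Fin 4)), ℂ))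
        (M₀ M₁ : ℝ), IsTensorOf F (fun i => ofRealTest (f i)) →
        tsupport (f 0 : EuclideanSpace ℝ (Fin 4) → ℝ) ⊆ closedBall c₀ ρ →
        tsupport (f 1 : EuclideanSpace ℝ (Fin 4) → ℝ) ⊆ closedBall c₁ ρ →
        (∀ x, |f 0 x| ≤ M₀) → (∀ x, |f 1 x| ≤ M₁) →
        ‖S₁ 2 F - κ * ((∫ x : EuclideanSpace ℝ (Fin 4), f 0 x : ℝ) : ℂ) *
            (κ * ((∫ x : EuclideanSpace ℝ (Fin 4), f 1 x : ℝ) : ℂ))‖ ≤ B * ρ ^ 8 * M₀ * M₁ := by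
    rcases halt with hfac | hM
    · -- factorising branch: the truncated part vanishes
      refine ⟨0, le_rfl, ?_⟩
      intro c₀ c₁ ρ hρ hdisj f F M₀ M₁ hF h0 h1 hM₀ hM₁
      have hFoff : IsOffDiagonal F := isOffDiagonal_of_isTensorOf_of_disjoint hF (hdisj.mono h0 h1)
      obtain ⟨F₀, hF₀⟩ := exists_isTensorOf (n := 1) (fun _ : Fin 1 => ofRealTest (f 0))
      obtain ⟨F₁, hF₁⟩ := exists_isTensorOf (n := 1) (fun _ : Fin 1 => ofRealTest (f 1))
      rw [hfac f F F₀ F₁ hF hFoff hF₀ hF₁, hκ (f 0) F₀ hF₀, hκ (f 1) F₁ hF₁, sub_self, norm_zero]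
      simp
    · -- bounded branch: L1 along the bounded subsequence, then the lattice tie
      obtain ⟨M, hM⟩ := hM
      obtain ⟨BQ, hBQ⟩ := r.curvature.bounded
      obtain ⟨φ, hφmono, hφM⟩ := Filter.extraction_of_frequently_atTop hM
      have hφa : Tendsto (fun j => sch.a (φ j)) atTop (𝓝 0) :=
        sch.tendsto_a.comp hφmono.tendsto_atTop
      refine ⟨M ^ 2 * (2 * BQ) ^ 2 * 3 ^ 8, by positivity, ?_⟩
      intro c₀ c₁ ρ hρ hdisj f F M₀ M₁ hF h0 h1 hM₀ hM₁
      have hFoff : IsOffDiagonal F := isOffDiagonal_of_isTensorOf_of_disjoint hF (hdisj.mono h0 h1)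
      obtain ⟨F₀, hF₀⟩ := exists_isTensorOf (n := 1) (fun _ : Fin 1 => ofRealTest (f 0))
      obtain ⟨F₁, hF₁⟩ := exists_isTensorOf (n := 1) (fun _ : Fin 1 => ofRealTest (f 1))
      have hLk := fun k => LatticeTruncatedTwoPointBound G r sch r.curvature BQ hBQ k f
      have hlat := eventually_norm_truncated_le' hρ h0 h1 hM₀ hM₁ sch.a_pos hφa hφM hLk
      have hu := (htie 2 two_ne_zero f F hF hFoff).comp hφmono.tendsto_atTop
      have hv := (htie 1 one_ne_zero (fun _ => f 0) F₀ hF₀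
        (HypercubicLimit.Negative.isOffDiagonal_fin_one F₀)).comp hφmono.tendsto_atTop
      have hw := (htie 1 one_ne_zero (fun _ => f 1) F₁ hF₁
        (HypercubicLimit.Negative.isOffDiagonal_fin_one F₁)).comp hφmono.tendsto_atTop
      have hZ : ‖S₁ 2 F - S₁ 1 F₀ * S₁ 1 F₁‖ ≤
          M ^ 2 * (2 * BQ) ^ 2 * ((3 * ρ) ^ 4 * M₀) * ((3 * ρ) ^ 4 * M₁) :=
        le_of_tendsto (hu.sub (hv.mul hw)).norm hlat
      rw [hκ (f 0) F₀ hF₀, hκ (f 1) F₁ hF₁] at hZ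
      exact hZ.trans (le_of_eq (by ring))
  -- ### the local bounds: `s₁ = 1`, `A₀ = ‖κ‖² + B`, `p₀ = 0`; `r₀ = s/2`, `A = ‖κ‖²`
  have hA₀ : 0 ≤ ‖κ‖ ^ 2 + B := by positivity
  refine ⟨1, ‖κ‖ ^ 2 + B, 0, one_pos, hA₀, fun s hs _ => ?_⟩
  refine ⟨s / 2, ‖κ‖ ^ 2, B, half_pos hs, sq_nonneg _, hB0, ?_, ?_⟩
  · rw [pow_zero]
    linarith
  · intro ρ hρ hρs f F M₀ M₁ hF h0 h1 hM₀ hM₁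
    have key := hB _ _ ρ hρ (disjoint_closedBall_single hs hρs) f F M₀ M₁ hF h0 h1 hM₀ hM₁
    calc ‖S₁ 2 F‖ ≤ ‖κ * ((∫ x : EuclideanSpace ℝ (Fin 4), f 0 x : ℝ) : ℂ) *
          (κ * ((∫ x : EuclideanSpace ℝ (Fin 4), f 1 x : ℝ) : ℂ))‖ +
        ‖S₁ 2 F - κ * ((∫ x : EuclideanSpace ℝ (Fin 4), f 0 x : ℝ) : ℂ) *
          (κ * ((∫ x : EuclideanSpace ℝ (Fin 4), f 1 x : ℝ) : ℂ))‖ := norm_le_insert' _ _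
      _ ≤ ‖κ‖ ^ 2 * (∫ x : EuclideanSpace ℝ (Fin 4), |f 0 x|) * (∫ x : EuclideanSpace ℝ (Fin 4), |f 1 x|) +
          B * ρ ^ 8 * M₀ * M₁ := add_le_add (norm_disconnected_le κ f) key

end Summit.QuantumFields.YangMills.Theorems.CurvatureKernel

end
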